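import Summits.HodgeConjecture.CorCM.MultiFieldWeilCommutantNoGo
import Mathlib.LinearAlgebra.LinearIndependent.Defs
import HarnessLib

/-!
# MULTI-FIELD WEIL ENGINE — THE COMMUTANT CRITERION: over EVERY transitive closed image, a family of position sets is separated by the signed equations
# IF AND ONLY IF its centred indicators are independent over the commutant of the image (census level)

Cell `pub-hodgecm2` (COR-CM), seat b30 gen 43 (2026-08-26); count-neutral own lane MULTI-FIELD WEIL ENGINE (stem `MultiFieldWeil*`), census level, the POSITIVE half and
the packaging of the commutant principle of `CorCM/MultiFieldWeilCommutantNoGo.lean` (E3, gen 42: an invariant-kernel relation between the centred indicators solves the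
signed equations).  Gen 39's `const_of_signed_unit_of_linearIndependent` (`2`-transitive images, commutant `ℚ`) and gen 42's `const_of_signed_dihedral_five` (the dihedral
pentagon, commutant `ℚ(√5)`, Fourier analysis on `ℤ/5`) were proved image by image; here ONE theorem covers every transitive image at once.  Theorems only; no definition,
no named fact, no `sorry`.  HONEST FRAMING: pure finite combinatorics ∕ linear algebra; `HC_CM` is NOT touched.

SETTING.  `H ⊆ Sym(k)` closed under products and inverses and TRANSITIVE on the `k` letters (the image of the realised tuples on the `τ`-embeddings of one CM field);
position sets `Q_i ⊆ Fin k` (`i ∈ ι`, the `τ`-parts of the CM types of one unit) with centred indicators `c_i = k·𝟙_{Q_i} − |Q_i|`; the SIGNED EQUATIONS of the unit ask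
that `Σ_i Σ_a ±_{σ a ∈ Q_i} u_i(a)` be the same integer for every `σ ∈ H`; the unit is SEPARATED when every solution `(u_i)` is constant slot by slot.  An INVARIANT KERNEL
is `G : Fin k × Fin k → ℤ` with `G(σ a, σ b) = G(a, b)` for `σ ∈ H` (an element of the commutant of the permutation matrices) with zero row and column sums (it kills and
avoids the constants: an endomorphism of the mass-zero module `V₀`).
* §1 AVERAGING (`sum_mul_right_eq_sum`, `sum_apply_eq_zero_of_transitive`): right translation by `τ ∈ H` permutes `H`; the `H`-sum `Σ_{σ ∈ H} f(σ a)` of a mass-zero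
  function vanishes at every letter (it does not depend on the letter by transitivity, and its total over the letters is `|H|·Σ f = 0`).
* §2 THE POSITIVE HALF (`const_of_signed_of_commutantIndependent`): if the only invariant kernels `G_i` with `Σ_i G_i c_i = 0` are `G_i = 0` (COMMUTANT-INDEPENDENCE of the
  `c_i`), the unit is separated.  PROOF (no Fourier analysis, no Maschke): with centred defects `ū_i = k u_i − Σ u_i` the signed equations say that the pairing
  `R(ρ) = Σ_i ⟨c_i, ū_i ∘ ρ⟩` is constant on `H` (`mul_signed_eq_two_mul_pairing`); the `H`-AVERAGED GRAM KERNELS `G_i(a, b) = Σ_{σ ∈ H} ū_j(σ a)·ū_i(σ b)` of a slot `j`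
  are invariant, have zero row and column sums (mass zero), and satisfy the relation: `Σ_i (G_i c_i)(a) = Σ_σ ū_j(σ a)·R(σ) = R·Σ_σ ū_j(σ a) = 0` by §1; so they vanish,
  and the diagonal entry `G_j(a, a) = Σ_σ ū_j(σ a)² = 0` at `σ = 1` gives `ū_j(a) = 0`: every `u_j` is constant.
* §3 THE NEGATIVE HALF AND THE EQUIVALENCE (`exists_nonconst_signed_of_kernel_relation`, `separated_iff_commutantIndependent`): a NON-ZERO invariant-kernel relation gives a
  solution with a NON-constant defect (E3's principle at `v = δ_b`; a kernel with zero row sums and constant rows is zero); hence, over every transitive closed image,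
  SEPARATED ⟺ COMMUTANT-INDEPENDENT — the reach of the units method at a field is exactly a statement about the commutant `End_H(V₀)` (`ℚ` for `2`-transitive images:
  at most `k − 1` classes, `ℚ`-independence; `ℚ(√5)` for the dihedral pentagon: pairs with different axes; `ℚ(ζ_k)` for a cyclic `k`-gon: one class).
* §4 THE USABLE FORM (`const_of_signed_of_kernelBasis`): if every invariant kernel is `g₀ J + Σ_t g_t A_t` for a fixed finite family of integer kernels `A_t` (e.g. the
  non-diagonal orbital matrices of `H`) and the vectors `A_t c_i` (`t`, `i`) are linearly independent over `ℚ`, the unit is separated — for a `2`-transitive image the family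
  is `{δ}` and this is gen 39's criterion; for the pentagon it is `{[b − a = ±1], [b − a = ±2]}` and this is gen 42's `ℚ(√5)`-criterion.
[cite: Serre1977, §2.3 Ex. 2.6; §13.1] [cite: DixonMortimer1996, §1.4 Ex. 1.4.1–1.4.2; §2.1; §3.2] [cite: Lang2002, XIII §4; XVII §1 (double centraliser)]

## References
* [Serre1977] J.-P. Serre, *Linear Representations of Finite Groups*, GTM 42, §2.3 Ex. 2.6 (the permutation representation and its commutant), §13.1.
* [DixonMortimer1996] J. D. Dixon, B. Mortimer, *Permutation Groups*, GTM 163, §1.4 Ex. 1.4.1–1.4.2, §2.1, §3.2 (orbitals, the centraliser algebra).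
* [Lang2002] S. Lang, *Algebra*, GTM 211, XIII §4, XVII §1.
-/

noncomputable section

namespace Summit.HodgeConjecture.CorCM.MultiFieldWeil

open Finset

open scoped Classical

/-! ## §1 Averaging over a transitive closed set of permutations -/

section Averaging

variable {k : ℕ} {H : Finset (Equiv.Perm (Fin k))}

/-- **Right translation permutes a closed set of permutations**: `Σ_{σ ∈ H} F(σ τ) = Σ_{σ ∈ H} F(σ)` for `τ ∈ H`, `H` closed under products and inverses.
[cite: DixonMortimer1996, §1.4 Ex. 1.4.1] -/
theorem sum_mul_right_eq_sum {β : Type} [AddCommMonoid β] (hmul : ∀ σ ∈ H, ∀ σ' ∈ H, σ * σ' ∈ H) (hinv : ∀ σ ∈ H, σ⁻¹ ∈ H)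
    (F : Equiv.Perm (Fin k) → β) {τ : Equiv.Perm (Fin k)} (hτ : τ ∈ H) : (∑ σ ∈ H, F (σ * τ)) = ∑ σ ∈ H, F σ :=
  Finset.sum_nbij' (fun σ => σ * τ) (fun σ => σ * τ⁻¹) (fun σ hσ => hmul σ hσ τ hτ) (fun σ hσ => hmul σ hσ _ (hinv τ hτ))
    (fun σ _ => mul_inv_cancel_right σ τ) (fun σ _ => inv_mul_cancel_right σ τ) (fun _ _ => rfl)

/-- **The `H`-sum of a mass-zero function at a letter vanishes** when `H` is closed under products and inverses and transitive: `Σ_{σ ∈ H} f(σ a) = 0` whenever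
`Σ_b f(b) = 0` (the sum does not depend on `a`, and its total over `a` is `|H|·Σ f`). [cite: DixonMortimer1996, §1.4 Ex. 1.4.2] [cite: Serre1977, §2.3 Ex. 2.6] -/
theorem sum_apply_eq_zero_of_transitive (hmul : ∀ σ ∈ H, ∀ σ' ∈ H, σ * σ' ∈ H) (hinv : ∀ σ ∈ H, σ⁻¹ ∈ H)
    (htrans : ∀ a b : Fin k, ∃ σ ∈ H, σ a = b) (f : Fin k → ℤ) (hf : ∑ b, f b = 0) (a : Fin k) : (∑ σ ∈ H, f (σ a)) = 0 := by
  have hind : ∀ b, (∑ σ ∈ H, f (σ b)) = ∑ σ ∈ H, f (σ a) := fun b => by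
    obtain ⟨τ, hτ, hτb⟩ := htrans a b
    rw [← hτb]
    have e : (∑ σ ∈ H, f (σ (τ a))) = ∑ σ ∈ H, (fun ρ : Equiv.Perm (Fin k) => f (ρ a)) (σ * τ) :=
      Finset.sum_congr rfl fun σ _ => rfl
    rw [e, sum_mul_right_eq_sum hmul hinv (fun ρ : Equiv.Perm (Fin k) => f (ρ a)) hτ]
  have htot : (∑ b, ∑ σ ∈ H, f (σ b)) = 0 := by
    rw [Finset.sum_comm]
    refine Finset.sum_eq_zero fun σ _ => ?_
    rw [Equiv.sum_comp σ f]
    exact hf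
  rw [Finset.sum_congr rfl fun b _ => hind b, Finset.sum_const, Finset.card_univ, Fintype.card_fin, nsmul_eq_mul] at htot
  have hk : (k : ℤ) ≠ 0 := by exact_mod_cast (Fin.pos a).ne'
  exact (mul_eq_zero.1 htot).resolve_left hk

/-- **The centred form of a signed sum, in `ℤ`** (no permutation: apply it to `u ∘ ρ`): `k·Σ_a ±_{a ∈ Q} u(a) = 2·Σ_a (k·[a ∈ Q] − |Q|)·u(a) + (2|Q| − k)·Σ u`.
[cite: Serre1977, §2.3 Ex. 2.6] -/
theorem mul_signed_eq_two_mul_pairing (Q : Finset (Fin k)) (u : Fin k → ℤ) :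
    (k : ℤ) * (∑ a, (if a ∈ Q then u a else -u a)) =
      2 * (∑ a, ((k : ℤ) * (if a ∈ Q then 1 else 0) - Q.card) * u a) + (2 * (Q.card : ℤ) - k) * ∑ a, u a := by
  have hite : ∀ a, (if a ∈ Q then u a else -u a) = (2 * (if a ∈ Q then (1 : ℤ) else 0) - 1) * u a := fun a => by
    split_ifs <;> ring
  rw [Finset.mul_sum, Finset.mul_sum, Finset.mul_sum, ← Finset.sum_add_distrib]
  refine Finset.sum_congr rfl fun a _ => ?_
  rw [hite]
  ring

end Averaging

/-! ## §2 The positive half: commutant-independence separates -/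

section Positive

variable {k : ℕ} {H : Finset (Equiv.Perm (Fin k))}

/-- **THE COMMUTANT CRITERION, POSITIVE HALF.**  `H ⊆ Sym(k)` closed under products and inverses and transitive; position sets `Q_i` (`i ∈ ι`).  Suppose the centred
indicators `c_i = k·𝟙_{Q_i} − |Q_i|` are COMMUTANT-INDEPENDENT: whenever integer kernels `G_i` invariant under `H` (`G_i(σ a, σ b) = G_i(a, b)`) with zero row and column sums
satisfy `Σ_i Σ_b G_i(a, b) c_i(b) = 0` for every `a`, all `G_i` vanish.  Then every solution `(u_i)` of the signed equations `Σ_i Σ_a ±_{σ a ∈ Q_i} u_i(a) = w` (`σ ∈ H`) is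
constant slot by slot.  Proof by the `H`-averaged Gram kernels of the centred defects, see the module docstring. [cite: Serre1977, §2.3 Ex. 2.6; §13.1]
[cite: DixonMortimer1996, §3.2] [cite: Lang2002, XVII §1] -/
theorem const_of_signed_of_commutantIndependent {ι : Type} [Fintype ι] [DecidableEq ι]
    (hmul : ∀ σ ∈ H, ∀ σ' ∈ H, σ * σ' ∈ H) (hinv : ∀ σ ∈ H, σ⁻¹ ∈ H) (htrans : ∀ a b : Fin k, ∃ σ ∈ H, σ a = b)
    (Q : ι → Finset (Fin k))
    (hind : ∀ G : ι → Fin k → Fin k → ℤ, (∀ σ ∈ H, ∀ i a b, G i (σ a) (σ b) = G i a b) → (∀ i a, ∑ b, G i a b = 0) →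
      (∀ i b, ∑ a, G i a b = 0) → (∀ a, ∑ i, ∑ b, G i a b * ((k : ℤ) * (if b ∈ Q i then 1 else 0) - (Q i).card) = 0) →
      ∀ i a b, G i a b = 0)
    (u : ι → Fin k → ℤ) {w : ℤ} (h : ∀ σ ∈ H, (∑ i, ∑ a, if σ a ∈ Q i then u i a else -u i a) = w)
    (j : ι) (a b : Fin k) : u j a = u j b := by
  -- notation: centred indicators, masses, centred defects (all in `ℤ`)
  set c : ι → Fin k → ℤ := fun i x => (k : ℤ) * (if x ∈ Q i then 1 else 0) - (Q i).card with hc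
  set S : ι → ℤ := fun i => ∑ x, u i x with hS
  set ub : ι → Fin k → ℤ := fun i x => (k : ℤ) * u i x - S i with hub
  have hk : (k : ℤ) ≠ 0 := by exact_mod_cast (Fin.pos a).ne'
  obtain ⟨σ₀, hσ₀, -⟩ := htrans a a
  have h1 : (1 : Equiv.Perm (Fin k)) ∈ H := by
    have := hmul σ₀ hσ₀ _ (hinv σ₀ hσ₀); rwa [mul_inv_cancel] at this
  have hc0 : ∀ i, ∑ x, c i x = 0 := fun i => by
    simp only [hc, Finset.sum_sub_distrib, ← Finset.mul_sum, Finset.sum_boole, Finset.sum_const, Finset.card_univ, Fintype.card_fin,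
      nsmul_eq_mul]
    simp
  have hub0 : ∀ i, ∑ x, ub i x = 0 := fun i => by
    simp only [hub, Finset.sum_sub_distrib, ← Finset.mul_sum, Finset.sum_const, Finset.card_univ, Fintype.card_fin, nsmul_eq_mul]
    exact sub_self _
  -- (1) the signed equations at `ρ⁻¹`, reindexed through `ρ`
  have h' : ∀ ρ ∈ H, (∑ i, ∑ x, if x ∈ Q i then u i (ρ x) else -u i (ρ x)) = w := fun ρ hρ => by
    rw [← h ρ⁻¹ (hinv ρ hρ)]
    refine Finset.sum_congr rfl fun i _ => ?_
    rw [← Equiv.sum_comp ρ (fun y => if ρ⁻¹ y ∈ Q i then u i y else -u i y)]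
    refine Finset.sum_congr rfl fun x _ => ?_
    rw [show ρ⁻¹ (ρ x) = x from ρ.symm_apply_apply x]
  -- (2) the pairing `R(ρ) = Σ_i Σ_x c_i(x) ū_i(ρ x)` is the same for every `ρ ∈ H`
  have hR : ∀ ρ ∈ H, 2 * (∑ i, ∑ x, c i x * ub i (ρ x)) = (k : ℤ) * ((k : ℤ) * w - ∑ i, (2 * ((Q i).card : ℤ) - k) * S i) := by
    intro ρ hρ
    have hSρ : ∀ i, ∑ x, u i (ρ x) = S i := fun i => Equiv.sum_comp ρ (u i)
    have hid : ∀ i, (k : ℤ) * (∑ x, if x ∈ Q i then u i (ρ x) else -u i (ρ x)) =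
        2 * (∑ x, c i x * u i (ρ x)) + (2 * ((Q i).card : ℤ) - k) * S i := fun i => by
      rw [← hSρ i]
      exact mul_signed_eq_two_mul_pairing (Q i) (fun x => u i (ρ x))
    have hcu : ∀ i, ∑ x, c i x * ub i (ρ x) = (k : ℤ) * ∑ x, c i x * u i (ρ x) := fun i => by
      have e : ∑ x, c i x * ub i (ρ x) = (k : ℤ) * ∑ x, c i x * u i (ρ x) - S i * ∑ x, c i x := by
        rw [Finset.mul_sum, Finset.mul_sum, ← Finset.sum_sub_distrib]
        exact Finset.sum_congr rfl fun x _ => by simp only [hub]; ring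
      rw [e, hc0 i, mul_zero, sub_zero]
    calc 2 * (∑ i, ∑ x, c i x * ub i (ρ x)) = ∑ i, (k : ℤ) * (2 * ∑ x, c i x * u i (ρ x)) := by
          rw [Finset.mul_sum]
          exact Finset.sum_congr rfl fun i _ => by rw [hcu]; ring
      _ = ∑ i, (k : ℤ) * ((k : ℤ) * (∑ x, if x ∈ Q i then u i (ρ x) else -u i (ρ x)) - (2 * ((Q i).card : ℤ) - k) * S i) := by
          exact Finset.sum_congr rfl fun i _ => by rw [hid]; ring
      _ = (k : ℤ) * ((k : ℤ) * w - ∑ i, (2 * ((Q i).card : ℤ) - k) * S i) := by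
          rw [← h' ρ hρ, Finset.mul_sum, ← Finset.sum_sub_distrib, Finset.mul_sum]
  have hRK : ∀ ρ ∈ H, (∑ i, ∑ x, c i x * ub i (ρ x)) = ∑ i, ∑ x, c i x * ub i (σ₀ x) := fun ρ hρ =>
    mul_left_cancel₀ (two_ne_zero : (2 : ℤ) ≠ 0) ((hR ρ hρ).trans (hR σ₀ hσ₀).symm)
  -- (3) the `H`-averaged Gram kernels of the slot `j`
  set G : ι → Fin k → Fin k → ℤ := fun i x y => ∑ σ ∈ H, ub j (σ x) * ub i (σ y) with hG
  have hGinv : ∀ τ ∈ H, ∀ i x y, G i (τ x) (τ y) = G i x y := fun τ hτ i x y => by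
    simp only [hG]
    have e : (∑ σ ∈ H, ub j (σ (τ x)) * ub i (σ (τ y))) = ∑ σ ∈ H, (fun ρ : Equiv.Perm (Fin k) => ub j (ρ x) * ub i (ρ y)) (σ * τ) :=
      Finset.sum_congr rfl fun σ _ => rfl
    rw [e, sum_mul_right_eq_sum hmul hinv (fun ρ : Equiv.Perm (Fin k) => ub j (ρ x) * ub i (ρ y)) hτ]
  have hGrow : ∀ i x, ∑ y, G i x y = 0 := fun i x => by
    simp only [hG]
    rw [Finset.sum_comm]
    refine Finset.sum_eq_zero fun σ _ => ?_
    rw [← Finset.mul_sum, Equiv.sum_comp σ (ub i), hub0 i, mul_zero]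
  have hGcol : ∀ i y, ∑ x, G i x y = 0 := fun i y => by
    simp only [hG]
    rw [Finset.sum_comm]
    refine Finset.sum_eq_zero fun σ _ => ?_
    rw [← Finset.sum_mul, Equiv.sum_comp σ (ub j), hub0 j, zero_mul]
  have hGrel : ∀ x, ∑ i, ∑ y, G i x y * c i y = 0 := fun x => by
    have e : ∑ i, ∑ y, G i x y * c i y = ∑ σ ∈ H, ub j (σ x) * ∑ i, ∑ y, c i y * ub i (σ y) := by
      calc ∑ i, ∑ y, G i x y * c i y = ∑ i, ∑ y, ∑ σ ∈ H, ub j (σ x) * (c i y * ub i (σ y)) := by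
            refine Finset.sum_congr rfl fun i _ => Finset.sum_congr rfl fun y _ => ?_
            simp only [hG, Finset.sum_mul]
            exact Finset.sum_congr rfl fun σ _ => by ring
        _ = ∑ i, ∑ σ ∈ H, ∑ y, ub j (σ x) * (c i y * ub i (σ y)) := Finset.sum_congr rfl fun i _ => Finset.sum_comm
        _ = ∑ σ ∈ H, ∑ i, ∑ y, ub j (σ x) * (c i y * ub i (σ y)) := Finset.sum_comm
        _ = ∑ σ ∈ H, ub j (σ x) * ∑ i, ∑ y, c i y * ub i (σ y) := by
            refine Finset.sum_congr rfl fun σ _ => ?_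
            rw [Finset.mul_sum]
            exact Finset.sum_congr rfl fun i _ => by rw [Finset.mul_sum]
    rw [e, Finset.sum_congr rfl fun σ hσ => by rw [hRK σ hσ], ← Finset.sum_mul,
      sum_apply_eq_zero_of_transitive hmul hinv htrans (ub j) (hub0 j) x, zero_mul]
  -- (4) commutant-independence kills the kernels
  have hG0 : ∀ i x y, G i x y = 0 := hind G hGinv hGrow hGcol hGrel
  -- (5) the diagonal entry `G_j(x, x) = Σ_σ ū_j(σ x)²` vanishes, so `ū_j(x) = 0` (`σ = 1`)
  have hdiag : ∀ x, ub j x = 0 := fun x => by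
    have hsum : (∑ σ ∈ H, ub j (σ x) * ub j (σ x)) = 0 := by
      have := hG0 j x x
      simp only [hG] at this
      exact this
    have hall := (Finset.sum_eq_zero_iff_of_nonneg fun σ _ => mul_self_nonneg (ub j (σ x))).1 hsum 1 h1
    rw [Equiv.Perm.one_apply] at hall
    exact mul_self_eq_zero.1 hall
  have ha := hdiag a
  have hb := hdiag b
  simp only [hub] at ha hb
  exact mul_left_cancel₀ hk (by linarith)

end Positive

/-! ## §3 The negative half with a non-constant defect; the equivalence -/

section Negative

variable {k : ℕ} {H : Finset (Equiv.Perm (Fin k))}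

/-- **THE COMMUTANT CRITERION, NEGATIVE HALF.**  `H ⊆ Sym(k)` arbitrary; a NON-ZERO family of `H`-invariant integer kernels `G_i` with zero row sums satisfying the relation
`Σ_i Σ_b G_i(a, b) c_i(b) = 0` gives integer defects, one of them NOT constant, whose total signed sum vanishes at every `σ ∈ H` (E3's principle at `v = δ_{b₁}`: `u_i = G_i(b₁, ·)`;
a kernel with zero row sums all of whose rows are constant is zero). [cite: Serre1977, §2.3 Ex. 2.6] [cite: Lang2002, XVII §1] -/
theorem exists_nonconst_signed_of_kernel_relation {ι : Type} [Fintype ι] (Q : ι → Finset (Fin k)) (G : ι → Fin k → Fin k → ℤ)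
    (hG : ∀ σ ∈ H, ∀ i a b, G i (σ a) (σ b) = G i a b) (hG0 : ∀ i b, ∑ a, G i b a = 0)
    (hrel : ∀ a, ∑ i, ∑ b, G i a b * ((k : ℤ) * (if b ∈ Q i then 1 else 0) - (Q i).card) = 0)
    (hne : ∃ i a b, G i a b ≠ 0) :
    ∃ u : ι → Fin k → ℤ, (∃ i a b, u i a ≠ u i b) ∧ ∀ σ ∈ H, (∑ i, ∑ a, if σ a ∈ Q i then u i a else -u i a) = 0 := by
  obtain ⟨i₀, a₀, b₀, hne⟩ := hne
  -- some row of `G_{i₀}` is not constant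
  obtain ⟨b₁, x, y, hxy⟩ : ∃ b₁ x y, G i₀ b₁ x ≠ G i₀ b₁ y := by
    by_contra hno
    push Not at hno
    have hrow : ∀ b x, G i₀ b x = 0 := fun b x => by
      have hs : ∑ a, G i₀ b a = (k : ℤ) * G i₀ b x := by
        rw [Finset.sum_congr rfl fun a _ => hno b a x, Finset.sum_const, Finset.card_univ, Fintype.card_fin, nsmul_eq_mul]
      have hk : (k : ℤ) ≠ 0 := by exact_mod_cast (Fin.pos x).ne'
      have := hG0 i₀ b
      rw [hs] at this
      exact (mul_eq_zero.1 this).resolve_left hk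
    exact hne (hrow a₀ b₀)
  refine ⟨fun i a => ∑ b, G i b a * (if b = b₁ then 1 else 0), ⟨i₀, x, y, ?_⟩,
    fun σ hσ => signed_eq_zero_of_kernel_relation Q G hG hG0 hrel _ σ hσ⟩
  have hval : ∀ a, (∑ b, G i₀ b a * (if b = b₁ then (1 : ℤ) else 0)) = G i₀ b₁ a := fun a => by
    rw [Finset.sum_eq_single b₁ (fun b _ hb => by rw [if_neg hb, mul_zero]) (fun hb => absurd (Finset.mem_univ _) hb), if_pos rfl, mul_one]
  show (∑ b, G i₀ b x * (if b = b₁ then (1 : ℤ) else 0)) ≠ ∑ b, G i₀ b y * (if b = b₁ then (1 : ℤ) else 0)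
  rw [hval, hval]
  exact hxy

/-- **THE COMMUTANT CRITERION (EQUIVALENCE).**  Over a transitive set `H ⊆ Sym(k)` closed under products and inverses, a family of position sets `Q_i` is SEPARATED (every
integer solution of `Σ_i Σ_a ±_{σ a ∈ Q_i} u_i(a) = w`, `σ ∈ H`, is constant slot by slot) IF AND ONLY IF its centred indicators `c_i = k·𝟙_{Q_i} − |Q_i|` are
COMMUTANT-INDEPENDENT (the only `H`-invariant integer kernels `G_i` with zero row and column sums and `Σ_i G_i c_i = 0` are `G_i = 0`).  READING: the reach of the units
method at one CM field is decided by the commutant `End_H(V₀)` of its image on the `τ`-embeddings. [cite: Serre1977, §2.3 Ex. 2.6; §13.1] [cite: DixonMortimer1996, §3.2]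
[cite: Lang2002, XVII §1] -/
theorem separated_iff_commutantIndependent {ι : Type} [Fintype ι] [DecidableEq ι]
    (hmul : ∀ σ ∈ H, ∀ σ' ∈ H, σ * σ' ∈ H) (hinv : ∀ σ ∈ H, σ⁻¹ ∈ H) (htrans : ∀ a b : Fin k, ∃ σ ∈ H, σ a = b)
    (Q : ι → Finset (Fin k)) :
    (∀ (u : ι → Fin k → ℤ) (w : ℤ), (∀ σ ∈ H, (∑ i, ∑ a, if σ a ∈ Q i then u i a else -u i a) = w) → ∀ i a b, u i a = u i b) ↔
    (∀ G : ι → Fin k → Fin k → ℤ, (∀ σ ∈ H, ∀ i a b, G i (σ a) (σ b) = G i a b) → (∀ i a, ∑ b, G i a b = 0) →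
      (∀ i b, ∑ a, G i a b = 0) → (∀ a, ∑ i, ∑ b, G i a b * ((k : ℤ) * (if b ∈ Q i then 1 else 0) - (Q i).card) = 0) →
      ∀ i a b, G i a b = 0) := by
  constructor
  · intro hsep G hG hrow _hcol hrel
    by_contra hno
    push Not at hno
    obtain ⟨u, ⟨i, a, b, hab⟩, hu⟩ := exists_nonconst_signed_of_kernel_relation Q G hG hrow hrel hno
    exact hab (hsep u 0 hu i a b)
  · intro hind u w h i a b
    exact const_of_signed_of_commutantIndependent hmul hinv htrans Q hind u h i a b

end Negative

/-! ## §4 The usable form: a spanning family of invariant kernels and `ℚ`-independence of the vectors `A_t c_i` -/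

section KernelBasis

variable {k : ℕ} {H : Finset (Equiv.Perm (Fin k))}

/-- **SEPARATION FROM A KERNEL BASIS.**  `H ⊆ Sym(k)` closed under products and inverses and transitive; integer kernels `A_t` (`t < s`) such that EVERY `H`-invariant
integer kernel is `g₀·J + Σ_t g_t A_t` with integer coefficients (`J` the all-ones kernel; e.g. `A_t` = the non-diagonal orbital matrices of `H`); if the `k`-vectors
`A_t c_i = (Σ_b A_t(a, b) c_i(b))_a` (`t < s`, `i ∈ ι`) are linearly independent over `ℚ`, the family `(Q_i)` is separated.  Instances: `2`-transitive `H`, `s = 1`,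
`A_0 = δ` (gen 39); the dihedral pentagon, `A_0 = [b − a = ±1]`, `A_1 = [b − a = ±2]` (gen 42). [cite: DixonMortimer1996, §3.2] [cite: Serre1977, §2.3 Ex. 2.6]
[cite: Lang2002, XIII §4] -/
theorem const_of_signed_of_kernelBasis {ι : Type} [Fintype ι] [DecidableEq ι] {s : ℕ}
    (hmul : ∀ σ ∈ H, ∀ σ' ∈ H, σ * σ' ∈ H) (hinv : ∀ σ ∈ H, σ⁻¹ ∈ H) (htrans : ∀ a b : Fin k, ∃ σ ∈ H, σ a = b)
    (Q : ι → Finset (Fin k)) (A : Fin s → Fin k → Fin k → ℤ)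
    (hspan : ∀ G : Fin k → Fin k → ℤ, (∀ σ ∈ H, ∀ a b, G (σ a) (σ b) = G a b) → ∃ g₀ : ℤ, ∃ g : Fin s → ℤ, ∀ a b, G a b = g₀ + ∑ t, g t * A t a b)
    (hli : LinearIndependent ℚ fun p : ι × Fin s => fun a : Fin k =>
      ∑ b, (A p.2 a b : ℚ) * ((k : ℚ) * (if b ∈ Q p.1 then 1 else 0) - (Q p.1).card))
    (u : ι → Fin k → ℤ) {w : ℤ} (h : ∀ σ ∈ H, (∑ i, ∑ a, if σ a ∈ Q i then u i a else -u i a) = w)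
    (j : ι) (a b : Fin k) : u j a = u j b := by
  refine const_of_signed_of_commutantIndependent hmul hinv htrans Q (fun G hG hrow _hcol hrel => ?_) u h j a b
  have hk : (k : ℤ) ≠ 0 := by exact_mod_cast (Fin.pos a).ne'
  choose g₀ g hg using fun i => hspan (G i) (fun σ hσ x y => hG σ hσ i x y)
  -- mass zero of the centred indicators
  have hc0 : ∀ i, ∑ x, ((k : ℤ) * (if x ∈ Q i then 1 else 0) - (Q i).card) = 0 := fun i => by
    simp only [Finset.sum_sub_distrib, ← Finset.mul_sum, Finset.sum_boole, Finset.sum_const, Finset.card_univ, Fintype.card_fin, nsmul_eq_mul]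
    simp
  -- the relation in terms of the coefficients `g i t`
  have e : ∀ i x, ∑ y, G i x y * ((k : ℤ) * (if y ∈ Q i then 1 else 0) - (Q i).card) =
      g₀ i * ∑ y, ((k : ℤ) * (if y ∈ Q i then 1 else 0) - (Q i).card) +
        ∑ t, g i t * ∑ y, A t x y * ((k : ℤ) * (if y ∈ Q i then 1 else 0) - (Q i).card) := fun i x => by
    rw [Finset.mul_sum, Finset.sum_congr rfl fun t _ => (Finset.mul_sum _ _ _), Finset.sum_comm, ← Finset.sum_add_distrib]
    refine Finset.sum_congr rfl fun y _ => ?_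
    rw [hg i x y, add_mul, Finset.sum_mul]
    exact congrArg₂ (· + ·) rfl (Finset.sum_congr rfl fun t _ => by ring)
  have hrelg : ∀ x, ∑ i, ∑ t, g i t * ∑ y, A t x y * ((k : ℤ) * (if y ∈ Q i then 1 else 0) - (Q i).card) = 0 := fun x => by
    calc ∑ i, ∑ t, g i t * ∑ y, A t x y * ((k : ℤ) * (if y ∈ Q i then 1 else 0) - (Q i).card)
        = ∑ i, ∑ y, G i x y * ((k : ℤ) * (if y ∈ Q i then 1 else 0) - (Q i).card) :=
          Finset.sum_congr rfl fun i _ => by rw [e i x, hc0 i, mul_zero, zero_add]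
      _ = 0 := hrel x
  -- cast to `ℚ` and read it as a vanishing linear combination of the vectors `A_t c_i`
  have hcomb : ∑ p : ι × Fin s, (g p.1 p.2 : ℚ) • (fun x : Fin k =>
      ∑ y, (A p.2 x y : ℚ) * ((k : ℚ) * (if y ∈ Q p.1 then 1 else 0) - (Q p.1).card)) = 0 := by
    funext x
    simp only [Finset.sum_apply, Pi.smul_apply, smul_eq_mul, Pi.zero_apply]
    rw [Fintype.sum_prod_type]
    have := congrArg (Int.cast : ℤ → ℚ) (hrelg x)
    push_cast at this
    exact this
  have hg0 : ∀ i t, g i t = 0 := fun i t => by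
    have := (Fintype.linearIndependent_iff.1 hli) (fun p => (g p.1 p.2 : ℚ)) hcomb (i, t)
    dsimp only at this
    exact_mod_cast this
  -- so `G i = g₀ i · J`, and the zero row sums give `g₀ i = 0`
  have hG' : ∀ i x y, G i x y = g₀ i := fun i x y => by
    rw [hg i x y, Finset.sum_eq_zero fun t _ => by rw [hg0 i t, zero_mul], add_zero]
  intro i x y
  have hs := hrow i x
  rw [Finset.sum_congr rfl fun y _ => hG' i x y, Finset.sum_const, Finset.card_univ, Fintype.card_fin, nsmul_eq_mul] at hs
  rw [hG' i x y]
  exact (mul_eq_zero.1 hs).resolve_left hk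

end KernelBasis

end Summit.HodgeConjecture.CorCM.MultiFieldWeil

end
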